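import Literature.NumberTheory.Automorphic.SymplecticSatakeIsomorphism
import Literature.NumberTheory.Automorphic.HyperspecialUnitarySphericalCharactersUnique
import HarnessLib

/-!
# The spherical characters of `Sp_{2n}`: every character of `ℋ_k(Sp_{2n}(K), Sp_{2n}(𝒪))` is an unramified eigencharacter
# `λ_χ = ev_χ ∘ 𝒮_q`, and `λ_χ = λ_{χ'}` iff `χ' ∈ W(C_n) · χ` (Cartier 1979 §IV Cor. 4.2 for `Sp_{2n}`, every rank, every
# algebraically closed coefficient field in which `q` is a unit)

Topic `NumberTheory/Automorphic`; namespace `Literature.NumberTheory.Automorphic.SymplecticCartan` (lane `lit-hodgefound`,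
Track 2 foundations; seat `lit-hodgefound-p11`, generation 50, row g50-#7).  DEFINITIONS with bodies (`signedPermSubgroup`,
`weylGroupAlgAut`, `weylGroupAction`, `latticeEvalChar`) + theorems; no named fact, no instance (the `W`-action on `k[ℤⁿ]` is a
`def`, used through `letI`), no notation.  The `Sp_{2n}` analogue of `HyperspecialUnitarySphericalCharacters[Unique]` (g48-#9/#10),
over ANY algebraically closed field `k` with `(q : k) = #𝓀` a unit (e.g. `ℂ`, `𝔽̄_ℓ` for `ℓ ∤ q`), on top of the Satake
isomorphism `symplecticSatakeAlgEquiv : ℋ_k ⥲ k[ℤⁿ]^{W(C_n)}` (g50-#6) and the tree's commutative algebra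
`FixedPointSubalgebraCharacters` (g48-#8: characters extend from invariants of a finite group; transitivity on the fibres).

## The mathematics

`G = Sp_{2n}(K)`, `K₀ = Sp_{2n}(𝒪)`, `W = W(C_n)` the signed permutations acting on `Λ = ℤⁿ` and on `B = k[ℤⁿ]`
(`x^μ ↦ x^{w μ}`), `A = B^W = 𝒮_q(ℋ_k)`.  For a character `χ : ℤⁿ → k` (multiplicative; `χ(μ) = Π βᵢ^{μᵢ}`, `β ∈ (kˣ)ⁿ`) the
unramified eigencharacter is `λ_χ = ev_χ ∘ 𝒮_q : ℋ_k → k` (`symplecticHeckeEigencharacter`).  [CartierCorvallis1979] §IV Cor. 4.2: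
«every homomorphism `ℋ(G, K) → ℂ` is `f ↦ Sf(χ)`; `χ` is unique up to `W`».  EXISTENCE: a character `ψ` of `ℋ_k` is, through
`𝒮_q`, a character of `A = B^W`; `W` is finite, so it extends to a character `Ψ` of `B` (integrality of `B` over `B^W`, lying
over, `B/𝔔 = k`), i.e. `Ψ = ev_χ` with `χ = Ψ|_{ℤⁿ}`, and `ψ = ev_χ ∘ 𝒮_q = λ_χ`.  UNIQUENESS: if `λ_χ = λ_{χ'}` then `ev_χ`,
`ev_{χ'}` agree on `A`, their kernels are maximal ideals of `B` over the same maximal ideal of `A`, hence conjugate under `W`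
([BourbakiAC5to7] V §2 no. 2 Thm. 2; Mathlib's `Algebra.IsInvariant.exists_smul_of_under_eq`): `ker ev_{χ'} = g · ker ev_χ`, so
`ev_{χ'} = ev_χ ∘ g⁻¹` (a character to the base field is determined by its kernel) and `χ' = χ ∘ w` for the signed permutation
`w = g⁻¹`.  Conversely `χ' = χ ∘ w` gives `λ_{χ'} = λ_χ` by the `W`-invariance of `𝒮_q(T)` (g50-#5).  Consequently
**`Hom_{k-alg}(ℋ_k(Sp_{2n}(K), Sp_{2n}(𝒪)), k) ≅ Hom(ℤⁿ, kˣ)/W(C_n) = (kˣ)ⁿ/W(C_n)`**, the unramified `L`-parameters of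
`Sp_{2n}` (semisimple classes in `SO_{2n+1}(k)`).

## What is formalised

* §1 **`signedPermEquiv_mul`/`_one`/`_inv`**, `signedPermSubgroup` (the range of `signedPermEquiv` IS a subgroup),
  **`mem_symplecticWeylGroup_iff`** (`W(C_n) = {signedPermEquiv ε π}`), **`finite_symplecticWeylGroup`**.
* §2 **`weylGroupAlgAut`** (`W → Aut_{k-alg} k[ℤⁿ]`), **`weylGroupAction`** (`MulSemiringAction`, a def), `weylGroupAction_smul`,
  **`forall_smul_eq_self_iff_mem_weylInvariants`**.
* §3 **`latticeEvalChar χ = ev_χ : k[ℤⁿ] →ₐ[k] k`**, `latticeEvalChar_single`, `symplecticHeckeEigencharacter_apply_eq_latticeEvalChar`,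
  `latticeEvalChar_smul_single_one`.
* §4 **`exists_eq_symplecticHeckeEigencharacter`** (EXISTENCE: every `ψ : ℋ_k →ₐ[k] k` is a `λ_χ`).
* §5 **`symplecticHeckeEigencharacter_eq_of_exists_signedPerm`** (⇐, any commutative `k`), **`exists_signedPerm_of_symplecticHeckeEigencharacter_eq`** (⇒),
  **`symplecticHeckeEigencharacter_eq_iff_exists_signedPerm`** (UNIQUENESS UP TO `W(C_n)`).

## References
* [CartierCorvallis1979] P. Cartier, *Representations of 𝔭-adic groups: a survey*, PSPM 33.1 (1979), §IV Cor. 4.2 and its proof.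
* [Satake1963] I. Satake, *Theory of spherical functions on reductive algebraic groups over 𝔭-adic fields*, Publ. Math. IHÉS 18
  (1963), §6 Thm. 7, §7.
* [BourbakiAC5to7] N. Bourbaki, *Algèbre commutative*, Ch. V §1 no. 9 Prop. 22, §2 no. 2 Thm. 2.
* [Macdonald1971] I. G. Macdonald, *Spherical functions on a group of p-adic type*, Madras (1971), Ch. III §3, Ch. IV.
* [GrossSatake1998] B. H. Gross, *On the Satake isomorphism* (1998), §§3, 6 (unramified parameters).
-/

noncomputable section

open scoped Valued WithZero MatrixGroups Pointwise
open Matrix MonoidAlgebra Representation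

namespace Literature.NumberTheory.Automorphic.SymplecticCartan

open Literature.NumberTheory.Automorphic Literature.NumberTheory.Automorphic.CartanUnique
  Literature.NumberTheory.Automorphic.HermitianLattice

variable {n : ℕ}

/-! ## §1 `W(C_n)` is the finite group of signed permutations -/

/-- `ε_i² = 1` for a sign. [cite: Satake1963, §7] -/
private theorem units_int_mul_self' (u : ℤˣ) : (u : ℤ) * u = 1 := by
  rw [← Units.val_mul, Int.units_mul_self, Units.val_one]

/-- **Composition of signed permutations**: `(ε, π) ∘ (ε', π') = ((ε_i ε'_{π i})_i, π' π)`. [cite: Satake1963, §7] -/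
theorem signedPermEquiv_mul (ε ε' : Fin n → ℤˣ) (π π' : Equiv.Perm (Fin n)) :
    signedPermEquiv ε π * signedPermEquiv ε' π' = signedPermEquiv (fun i => ε i * ε' (π i)) (π' * π) := by
  refine LinearEquiv.ext fun μ => ?_
  rw [LinearEquiv.mul_apply, signedPermEquiv_apply, signedPermEquiv_apply, signedPermEquiv_apply]
  funext i
  rw [Units.val_mul, Equiv.Perm.mul_apply, mul_assoc]

/-- The trivial signed permutation is the identity. [cite: Satake1963, §7] -/
theorem signedPermEquiv_one : signedPermEquiv (fun _ : Fin n => (1 : ℤˣ)) 1 = 1 := by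
  refine LinearEquiv.ext fun μ => ?_
  rw [signedPermEquiv_apply]
  change (fun i => ((1 : ℤˣ) : ℤ) * μ ((1 : Equiv.Perm (Fin n)) i)) = μ
  funext i
  rw [Units.val_one, one_mul, Equiv.Perm.one_apply]

/-- **Inverse of a signed permutation**: `(ε, π)⁻¹ = ((ε_{π⁻¹ j})_j, π⁻¹)`. [cite: Satake1963, §7] -/
theorem signedPermEquiv_inv (ε : Fin n → ℤˣ) (π : Equiv.Perm (Fin n)) :
    (signedPermEquiv ε π)⁻¹ = signedPermEquiv (fun j => ε (π.symm j)) π.symm := by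
  refine inv_eq_of_mul_eq_one_right ?_
  rw [signedPermEquiv_mul, ← signedPermEquiv_one (n := n)]
  have hπ : π.symm * π = 1 := Equiv.ext fun i => by simp
  congr 1
  funext i
  rw [Equiv.symm_apply_apply, Int.units_mul_self]

/-- The signed permutations form a subgroup of `Aut_ℤ(ℤⁿ)` (as a set: the range of `signedPermEquiv`). [cite: Satake1963, §7] -/
def signedPermSubgroup (n : ℕ) : Subgroup ((Fin n → ℤ) ≃ₗ[ℤ] (Fin n → ℤ)) where
  carrier := Set.range fun p : (Fin n → ℤˣ) × Equiv.Perm (Fin n) => signedPermEquiv p.1 p.2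
  mul_mem' := by
    rintro _ _ ⟨⟨ε, π⟩, rfl⟩ ⟨⟨ε', π'⟩, rfl⟩
    exact ⟨(fun i => ε i * ε' (π i), π' * π), (signedPermEquiv_mul ε ε' π π').symm⟩
  one_mem' := ⟨(fun _ => 1, 1), signedPermEquiv_one⟩
  inv_mem' := by
    rintro _ ⟨⟨ε, π⟩, rfl⟩
    exact ⟨(fun j => ε (π.symm j), π.symm), (signedPermEquiv_inv ε π).symm⟩

/-- **`W(C_n)` consists exactly of the signed permutations.** [cite: Satake1963, §7] [cite: BruhatTits1972, (4.4.3)] -/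
theorem mem_symplecticWeylGroup_iff (w : (Fin n → ℤ) ≃ₗ[ℤ] (Fin n → ℤ)) :
    w ∈ symplecticWeylGroup n ↔ ∃ (ε : Fin n → ℤˣ) (π : Equiv.Perm (Fin n)), w = signedPermEquiv ε π := by
  constructor
  · intro hw
    have hle : symplecticWeylGroup n ≤ signedPermSubgroup n := by
      unfold symplecticWeylGroup
      rw [Subgroup.closure_le]
      rintro _ ⟨p, rfl⟩
      exact ⟨p, rfl⟩
    obtain ⟨⟨ε, π⟩, h⟩ := hle hw
    exact ⟨ε, π, h.symm⟩
  · rintro ⟨ε, π, rfl⟩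
    exact signedPermEquiv_mem_symplecticWeylGroup ε π

/-- **`W(C_n)` is finite** (of order `2^n n!`). [cite: Satake1963, §7] -/
theorem finite_symplecticWeylGroup : Finite (symplecticWeylGroup n) := by
  have h : (symplecticWeylGroup n : Set ((Fin n → ℤ) ≃ₗ[ℤ] (Fin n → ℤ))) =
      Set.range (fun p : (Fin n → ℤˣ) × Equiv.Perm (Fin n) => signedPermEquiv p.1 p.2) := by
    ext w
    rw [SetLike.mem_coe, mem_symplecticWeylGroup_iff, Set.mem_range]
    constructor
    · rintro ⟨ε, π, rfl⟩; exact ⟨(ε, π), rfl⟩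
    · rintro ⟨p, rfl⟩; exact ⟨p.1, p.2, rfl⟩
  have hfin : (symplecticWeylGroup n : Set ((Fin n → ℤ) ≃ₗ[ℤ] (Fin n → ℤ))).Finite := by
    rw [h]; exact Set.finite_range _
  exact hfin.to_subtype

/-! ## §2 `W(C_n)` acting on `k[ℤⁿ]` by algebra automorphisms -/

section Action

variable (n) (k : Type*) [CommRing k]

/-- **`W(C_n) → Aut_{k-alg}(k[ℤⁿ])`**, `w ↦ (x^μ ↦ x^{w μ})` (domain congruence along `w`). [cite: CartierCorvallis1979, §IV Cor. 4.2] -/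
def weylGroupAlgAut : symplecticWeylGroup n →* (AddMonoidAlgebra k (Fin n → ℤ) ≃ₐ[k] AddMonoidAlgebra k (Fin n → ℤ)) where
  toFun w := AddMonoidAlgebra.domCongr k k (w : (Fin n → ℤ) ≃ₗ[ℤ] (Fin n → ℤ)).toAddEquiv
  map_one' := by
    refine AlgEquiv.ext fun f => AddMonoidAlgebra.ext (Finsupp.ext fun m => ?_)
    rw [AddMonoidAlgebra.coeff_domCongr, AlgEquiv.one_apply]
    rfl
  map_mul' w w' := by
    refine AlgEquiv.ext fun f => AddMonoidAlgebra.ext (Finsupp.ext fun m => ?_)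
    rw [AddMonoidAlgebra.coeff_domCongr, AlgEquiv.mul_apply, AddMonoidAlgebra.coeff_domCongr, AddMonoidAlgebra.coeff_domCongr]
    rfl

/-- The `W(C_n)`-action on `k[ℤⁿ]` as a `MulSemiringAction` (a definition, used through `letI`). [cite: CartierCorvallis1979, §IV Cor. 4.2] -/
@[reducible] def weylGroupAction : MulSemiringAction (symplecticWeylGroup n) (AddMonoidAlgebra k (Fin n → ℤ)) :=
  MulSemiringAction.compHom _ (weylGroupAlgAut n k)

variable {n k}

/-- Under `weylGroupAction`, `w • f = domCongr w f`. [cite: CartierCorvallis1979, §IV Cor. 4.2] -/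
theorem weylGroupAction_smul (w : symplecticWeylGroup n) (f : AddMonoidAlgebra k (Fin n → ℤ)) :
    (letI := weylGroupAction n k; w • f) = AddMonoidAlgebra.domCongr k k (w : (Fin n → ℤ) ≃ₗ[ℤ] (Fin n → ℤ)).toAddEquiv f := rfl

/-- **The fixed points of the action are the Weyl invariants `k[ℤⁿ]^{W(C_n)}`.** [cite: CartierCorvallis1979, §IV.2, Cor. 4.2] -/
theorem forall_smul_eq_self_iff_mem_weylInvariants (f : AddMonoidAlgebra k (Fin n → ℤ)) :
    (∀ w : symplecticWeylGroup n, (letI := weylGroupAction n k; w • f) = f) ↔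
      f ∈ weylInvariants k (Fin n → ℤ) (symplecticWeylGroup n) := by
  rw [mem_weylInvariants_iff]
  exact ⟨fun h w hw => h ⟨w, hw⟩, fun h w => h w.1 w.2⟩

end Action

/-! ## §3 The characters `ev_χ` of `k[ℤⁿ]` -/

section EvalChar

variable {k : Type*} [CommRing k]

/-- **`ev_χ : k[ℤⁿ] →ₐ[k] k`**, evaluation at a character `χ` of the lattice `ℤⁿ` (`x^μ ↦ χ(μ)`). [cite: CartierCorvallis1979, §IV Cor. 4.2] -/
def latticeEvalChar (χ : Multiplicative (Fin n → ℤ) →* k) : AddMonoidAlgebra k (Fin n → ℤ) →ₐ[k] k :=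
  AddMonoidAlgebra.lift k k (Fin n → ℤ) χ

/-- `ev_χ(c x^μ) = c χ(μ)`. [cite: CartierCorvallis1979, §IV Cor. 4.2] -/
theorem latticeEvalChar_single (χ : Multiplicative (Fin n → ℤ) →* k) (μ : Fin n → ℤ) (c : k) :
    latticeEvalChar χ (AddMonoidAlgebra.single μ c) = c * χ (Multiplicative.ofAdd μ) := by
  rw [latticeEvalChar, AddMonoidAlgebra.lift_single, smul_eq_mul]

/-- `ev_χ(w • x^μ) = χ(w μ)`. [cite: CartierCorvallis1979, §IV Cor. 4.2] -/
theorem latticeEvalChar_smul_single_one (χ : Multiplicative (Fin n → ℤ) →* k) (w : symplecticWeylGroup n) (μ : Fin n → ℤ) :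
    latticeEvalChar χ (letI := weylGroupAction n k; w • AddMonoidAlgebra.single μ (1 : k)) =
      χ (Multiplicative.ofAdd ((w : (Fin n → ℤ) ≃ₗ[ℤ] (Fin n → ℤ)) μ)) := by
  rw [weylGroupAction_smul, AddMonoidAlgebra.domCongr_single, latticeEvalChar_single, one_mul]
  rfl

variable {K : Type*} [Field K] [Valued K ℤᵐ⁰] {ϖ : K}

/-- `λ_χ(T) = ev_χ(𝒮_q T)`. [cite: CartierCorvallis1979, §IV (4.2), Cor. 4.2] -/
theorem symplecticHeckeEigencharacter_apply_eq_latticeEvalChar (hϖ : Valued.v ϖ = WithZero.exp (-1 : ℤ)) (q : kˣ)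
    (χ : Multiplicative (Fin n → ℤ) →* k) (T : heckeAlgebra k (symplecticGroup (Fin n) K) (symplecticInt (Fin n) K)) :
    symplecticHeckeEigencharacter hϖ q χ T = latticeEvalChar χ (symplecticSatakeTransform hϖ q T) := rfl

end EvalChar

/-! ## §4 Existence: every character of `ℋ_k(Sp_{2n}(K), Sp_{2n}(𝒪))` is a `λ_χ` -/

section Existence

variable {k : Type*} [Field k] [IsAlgClosed k] {K : Type*} [Field K] [Valued K ℤᵐ⁰] {ϖ : K} [CompactSpace 𝒪[K]] [Finite 𝓀[K]]

/-- **CARTIER COR. 4.2 (EXISTENCE) FOR `Sp_{2n}` IN EVERY RANK**: over an algebraically closed field `k` with `(q : k) = #𝓀` a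
unit, every `k`-algebra homomorphism `ψ : ℋ_k(Sp_{2n}(K), Sp_{2n}(𝒪)) → k` is an unramified Hecke eigencharacter
`λ_χ = ev_χ ∘ 𝒮_q` for some character `χ` of `ℤⁿ`. [cite: CartierCorvallis1979, §IV Cor. 4.2] [cite: Satake1963, §7]
[cite: Macdonald1971, Ch. III §3] -/
theorem exists_eq_symplecticHeckeEigencharacter (hϖ : Valued.v ϖ = WithZero.exp (-1 : ℤ)) (q : kˣ) (hq : (q : k) = Nat.card 𝓀[K])
    (ψ : heckeAlgebra k (symplecticGroup (Fin n) K) (symplecticInt (Fin n) K) →ₐ[k] k) :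
    ∃ χ : Multiplicative (Fin n → ℤ) →* k, ψ = symplecticHeckeEigencharacter hϖ q χ := by
  classical
  letI := weylGroupAction n k
  haveI := finite_symplecticWeylGroup (n := n)
  set A : Subalgebra k (AddMonoidAlgebra k (Fin n → ℤ)) := weylInvariants k (Fin n → ℤ) (symplecticWeylGroup n) with hAdef
  have hA : ∀ b : AddMonoidAlgebra k (Fin n → ℤ), (∀ g : symplecticWeylGroup n, g • b = b) → b ∈ A := fun b hb =>
    (forall_smul_eq_self_iff_mem_weylInvariants b).1 hb
  -- the character `φ = ψ ∘ 𝒮_q⁻¹` of `A`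
  set φ : A →ₐ[k] k := ψ.comp (symplecticSatakeAlgEquiv hϖ q hq).symm.toAlgHom with hφ
  obtain ⟨Ψ, hΨ⟩ := exists_algHom_extend_of_fixedPoints A hA φ
  set χ : Multiplicative (Fin n → ℤ) →* k := (AddMonoidAlgebra.lift k k (Fin n → ℤ)).symm Ψ with hχ
  have hΨχ : Ψ = latticeEvalChar χ := by rw [latticeEvalChar, hχ, Equiv.apply_symm_apply]
  refine ⟨χ, AlgHom.ext fun T => ?_⟩
  have hmem := symplecticSatakeTransform_mem_weylInvariants hϖ q hq T
  have h1 : ψ T = φ ⟨symplecticSatakeTransform hϖ q T, hmem⟩ := by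
    change ψ T = ψ ((symplecticSatakeAlgEquiv hϖ q hq).symm ⟨symplecticSatakeTransform hϖ q T, hmem⟩)
    rw [symplecticSatakeAlgEquiv_symm_apply_symplecticSatakeTransform]
  rw [h1, ← hΨ ⟨_, hmem⟩, symplecticHeckeEigencharacter_apply_eq_latticeEvalChar, hΨχ]

/-- The same with the parameter as a point `β ∈ (kˣ)ⁿ`: `χ(μ) = Π βᵢ^{μᵢ}`. [cite: CartierCorvallis1979, §IV Cor. 4.2] [cite: GrossSatake1998, §6] -/
theorem exists_eq_symplecticHeckeEigencharacter_point (hϖ : Valued.v ϖ = WithZero.exp (-1 : ℤ)) (q : kˣ) (hq : (q : k) = Nat.card 𝓀[K])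
    (ψ : heckeAlgebra k (symplecticGroup (Fin n) K) (symplecticInt (Fin n) K) →ₐ[k] k) :
    ∃ (β : Fin n → kˣ) (χ : Multiplicative (Fin n → ℤ) →* k),
      (∀ μ : Fin n → ℤ, χ (Multiplicative.ofAdd μ) = ((∏ i, β i ^ μ i : kˣ) : k)) ∧ ψ = symplecticHeckeEigencharacter hϖ q χ := by
  obtain ⟨χ, hχ⟩ := exists_eq_symplecticHeckeEigencharacter hϖ q hq ψ
  exact ⟨fun i => χ.toHomUnits (Multiplicative.ofAdd (Pi.single i (1 : ℤ))), χ, fun μ => map_ofAdd_eq_coe_prod_toHomUnits χ μ, hχ⟩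

end Existence

/-! ## §5 Uniqueness up to `W(C_n)` -/

section Invariance

variable {k : Type*} [CommRing k] {K : Type*} [Field K] [Valued K ℤᵐ⁰] {ϖ : K} [CompactSpace 𝒪[K]] [Finite 𝓀[K]]

/-- **(⇐) `W`-conjugate parameters give the same eigencharacter**: if `χ'(μ) = χ(w μ)` for a signed permutation `w = (ε, π)`
then `λ_{χ'} = λ_χ` (the coefficients of `𝒮_q(T)` are `W(C_n)`-invariant; any commutative `k`). [cite: CartierCorvallis1979, §IV Cor. 4.2] [cite: Satake1963, §7] -/
theorem symplecticHeckeEigencharacter_eq_of_exists_signedPerm (hϖ : Valued.v ϖ = WithZero.exp (-1 : ℤ)) (q : kˣ)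
    (hq : (q : k) = Nat.card 𝓀[K]) {χ χ' : Multiplicative (Fin n → ℤ) →* k} (ε : Fin n → ℤˣ) (π : Equiv.Perm (Fin n))
    (h : ∀ μ : Fin n → ℤ, χ' (Multiplicative.ofAdd μ) = χ (Multiplicative.ofAdd fun i => (ε i : ℤ) * μ (π i))) :
    symplecticHeckeEigencharacter hϖ q χ' = symplecticHeckeEigencharacter hϖ q χ := by
  refine AlgHom.ext fun T => ?_
  rw [symplecticHeckeEigencharacter_apply_eq_latticeEvalChar, symplecticHeckeEigencharacter_apply_eq_latticeEvalChar]
  have hχ' : χ' = χ.comp (AddMonoidHom.toMultiplicative (signedPermEquiv ε π).toAddEquiv.toAddMonoidHom) := by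
    refine MonoidHom.ext fun m => ?_
    have hm : m = Multiplicative.ofAdd (Multiplicative.toAdd m) := rfl
    rw [hm, h, MonoidHom.comp_apply]
    change _ = χ (Multiplicative.ofAdd (signedPermEquiv ε π (Multiplicative.toAdd m)))
    rw [signedPermEquiv_apply]
  have hfix := (mem_weylInvariants_iff _).1 (symplecticSatakeTransform_mem_weylInvariants hϖ q hq T) _
    (signedPermEquiv_mem_symplecticWeylGroup ε π)
  rw [latticeEvalChar, latticeEvalChar, hχ', lift_comp_toMultiplicative_eq_lift_domCongr]
  exact congrArg _ hfix

end Invariance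

section Unique

variable {k : Type*} [Field k] {K : Type*} [Field K] [Valued K ℤᵐ⁰] {ϖ : K} [CompactSpace 𝒪[K]] [Finite 𝓀[K]]

/-- **(⇒) Equal eigencharacters have `W(C_n)`-conjugate parameters**: if `λ_{χ'} = λ_χ` then `χ'(μ) = χ(ε_i μ_{π i})_i` for
some signed permutation `(ε, π)` (transitivity of the finite group `W` on the maximal ideals of `k[ℤⁿ]` over a maximal ideal of
`k[ℤⁿ]^W`; any field `k`).
[cite: CartierCorvallis1979, §IV Cor. 4.2] [cite: BourbakiAC5to7, Ch. V §2 no. 2 Thm. 2] -/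
theorem exists_signedPerm_of_symplecticHeckeEigencharacter_eq (hϖ : Valued.v ϖ = WithZero.exp (-1 : ℤ)) (q : kˣ)
    (hq : (q : k) = Nat.card 𝓀[K]) {χ χ' : Multiplicative (Fin n → ℤ) →* k}
    (h : symplecticHeckeEigencharacter (K := K) (n := n) hϖ q χ' = symplecticHeckeEigencharacter hϖ q χ) :
    ∃ (ε : Fin n → ℤˣ) (π : Equiv.Perm (Fin n)),
      ∀ μ : Fin n → ℤ, χ' (Multiplicative.ofAdd μ) = χ (Multiplicative.ofAdd fun i => (ε i : ℤ) * μ (π i)) := by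
  classical
  letI := weylGroupAction n k
  haveI := finite_symplecticWeylGroup (n := n)
  -- `A = k[ℤⁿ]^W ⊆ B = k[ℤⁿ]`
  set A : Subalgebra k (AddMonoidAlgebra k (Fin n → ℤ)) := weylInvariants k (Fin n → ℤ) (symplecticWeylGroup n) with hAdef
  have hAfix : ∀ b : AddMonoidAlgebra k (Fin n → ℤ), b ∈ A ↔ ∀ g : symplecticWeylGroup n, g • b = b := fun b =>
    (forall_smul_eq_self_iff_mem_weylInvariants b).symm
  haveI : Algebra.IsInvariant A (AddMonoidAlgebra k (Fin n → ℤ)) (symplecticWeylGroup n) :=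
    ⟨fun b hb => ⟨⟨b, (hAfix b).2 hb⟩, rfl⟩⟩
  haveI : SMulCommClass (symplecticWeylGroup n) A (AddMonoidAlgebra k (Fin n → ℤ)) :=
    ⟨fun g a b => by
      rw [Algebra.smul_def, Algebra.smul_def, smul_mul']
      show g • (a : AddMonoidAlgebra k (Fin n → ℤ)) * g • b = (a : AddMonoidAlgebra k (Fin n → ℤ)) * g • b
      rw [(hAfix a.1).1 a.2 g]⟩
  -- the two characters `ev_χ`, `ev_{χ'}` agree on `A = 𝒮_q(ℋ_k)`
  have hagree : ∀ a : A, latticeEvalChar χ' (a : AddMonoidAlgebra k (Fin n → ℤ)) = latticeEvalChar χ a := fun a => by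
    obtain ⟨T, hT⟩ := exists_symplecticSatakeTransform_eq hϖ q hq a.1 a.2
    rw [← hT, ← symplecticHeckeEigencharacter_apply_eq_latticeEvalChar, ← symplecticHeckeEigencharacter_apply_eq_latticeEvalChar, h]
  have hsurj : ∀ γ : Multiplicative (Fin n → ℤ) →* k, Function.Surjective (latticeEvalChar (n := n) γ) := fun γ c =>
    ⟨algebraMap k _ c, AlgHom.commutes _ c⟩
  haveI hM : (RingHom.ker (latticeEvalChar χ)).IsMaximal := RingHom.ker_isMaximal_of_surjective _ (hsurj χ)
  haveI hM' : (RingHom.ker (latticeEvalChar χ')).IsMaximal := RingHom.ker_isMaximal_of_surjective _ (hsurj χ')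
  have hunder : (RingHom.ker (latticeEvalChar χ)).under A = (RingHom.ker (latticeEvalChar χ')).under A := by
    refine Ideal.ext fun a => ?_
    change a ∈ (RingHom.ker (latticeEvalChar χ)).comap (algebraMap A _) ↔ a ∈ (RingHom.ker (latticeEvalChar χ')).comap (algebraMap A _)
    rw [Ideal.mem_comap, Ideal.mem_comap, RingHom.mem_ker, RingHom.mem_ker]
    show latticeEvalChar χ (a : AddMonoidAlgebra k (Fin n → ℤ)) = 0 ↔ latticeEvalChar χ' (a : AddMonoidAlgebra k (Fin n → ℤ)) = 0
    rw [hagree]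
  obtain ⟨g, hg⟩ := Algebra.IsInvariant.exists_smul_of_under_eq (A := A) (B := AddMonoidAlgebra k (Fin n → ℤ))
    (G := symplecticWeylGroup n) (P := RingHom.ker (latticeEvalChar χ)) (Q := RingHom.ker (latticeEvalChar χ')) hunder
  -- `ev_{χ'} = ev_χ ∘ (g⁻¹ • ·)`: both are characters with the same kernel
  set Φ : AddMonoidAlgebra k (Fin n → ℤ) →ₐ[k] k := (latticeEvalChar χ).comp (weylGroupAlgAut n k g⁻¹ : _ ≃ₐ[k] _).toAlgHom with hΦ
  have hΦapply : ∀ b, Φ b = latticeEvalChar χ (g⁻¹ • b) := fun b => rfl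
  have hker : RingHom.ker Φ ≤ RingHom.ker (latticeEvalChar χ') := fun b hb => by
    rw [RingHom.mem_ker] at hb ⊢
    have h1 : g⁻¹ • b ∈ RingHom.ker (latticeEvalChar χ) := by rw [RingHom.mem_ker]; exact hb
    have h2 : b ∈ g • RingHom.ker (latticeEvalChar χ) := Ideal.mem_pointwise_smul_iff_inv_smul_mem.2 h1
    rw [← hg, RingHom.mem_ker] at h2
    exact h2
  have heq : latticeEvalChar χ' = Φ := algHom_eq_of_ker_le Φ (latticeEvalChar χ') hker
  -- `g⁻¹` is a signed permutation
  obtain ⟨ε, π, hgw⟩ := (mem_symplecticWeylGroup_iff _).1 (g⁻¹).2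
  refine ⟨ε, π, fun μ => ?_⟩
  have h1 : latticeEvalChar χ' (AddMonoidAlgebra.single μ 1) = Φ (AddMonoidAlgebra.single μ 1) := by rw [heq]
  rw [hΦapply, latticeEvalChar_smul_single_one, latticeEvalChar_single, one_mul] at h1
  rw [h1]
  change χ (Multiplicative.ofAdd (((g⁻¹ : symplecticWeylGroup n) : (Fin n → ℤ) ≃ₗ[ℤ] (Fin n → ℤ)) μ)) = _
  rw [hgw, signedPermEquiv_apply]

/-- **CARTIER COR. 4.2 FOR `Sp_{2n}`, UNIQUENESS UP TO `W(C_n)`, EVERY RANK**: `λ_{χ'} = λ_χ` iff `χ' = χ ∘ w` for a signed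
permutation `w`.  With `exists_eq_symplecticHeckeEigencharacter`:
`Hom_{k-alg}(ℋ_k(Sp_{2n}(K), Sp_{2n}(𝒪)), k) ≅ Hom(ℤⁿ, kˣ)/W(C_n) = (kˣ)ⁿ/W(C_n)` (`k` algebraically closed for the surjection,
`(q : k) = #𝓀 ∈ kˣ`; the injectivity holds over every field).
[cite: CartierCorvallis1979, §IV Cor. 4.2] [cite: Satake1963, §7] [cite: GrossSatake1998, §6] -/
theorem symplecticHeckeEigencharacter_eq_iff_exists_signedPerm (hϖ : Valued.v ϖ = WithZero.exp (-1 : ℤ)) (q : kˣ)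
    (hq : (q : k) = Nat.card 𝓀[K]) (χ χ' : Multiplicative (Fin n → ℤ) →* k) :
    symplecticHeckeEigencharacter (K := K) (n := n) hϖ q χ' = symplecticHeckeEigencharacter hϖ q χ ↔
      ∃ (ε : Fin n → ℤˣ) (π : Equiv.Perm (Fin n)),
        ∀ μ : Fin n → ℤ, χ' (Multiplicative.ofAdd μ) = χ (Multiplicative.ofAdd fun i => (ε i : ℤ) * μ (π i)) :=
  ⟨exists_signedPerm_of_symplecticHeckeEigencharacter_eq hϖ q hq,
    fun ⟨ε, π, h⟩ => symplecticHeckeEigencharacter_eq_of_exists_signedPerm hϖ q hq ε π h⟩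

end Unique

end Literature.NumberTheory.Automorphic.SymplecticCartan

end
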